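import Summits.QuantumFields.YangMills.Theorems.BalabanUVNodesN15KingModelGraphTreeDecayContinuumKernel

/-!
# BalabanUVNodes ∕ N15 — THE KING-MODEL RUNG (PART Β-f): NE2's UNIT LAYER AGAINST THE CONTINUUM KERNEL («n = ∞» IN LEMMA 4.5 (4.38)'s SHAPE) — THE η-DIFFERENCE
# OF A TWO-LEGGED (3.56)-KERNEL TO ITS `K → ∞` LIMIT INHABITS `T4EtaRate.EtaRateIneqUnit` ∕ `NE2PlusUnit`, BY NAME AT `A = 0`
# (Track A, DAG node N15 = NE2; FAN-OUT v1.1 §N15 s3 «KING-MODEL RUNG … NE2's analogue DECIDED in the model; the seat types `NE2_in_KingModel`»)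

HONEST FRAMING.  Count-neutral (cell `pub-ymgap`, seat `pub-ymgap-dag-n15-e` g30; `--supports stmt-QuantumFields-27366 --as helper` = K3⁸
`SpineGivenEndpointR13SepCoPHV`).  TEMPLATE LITERATURE: C. King, *The U(1) Higgs model. I. The continuum limit*, Commun. Math. Phys. **102** (1986) 649–677
[King1986]: Lemma 4.5 (4.38) p. 674 (shape `CL^{−k}e^{−δ₀|x−y|}`, here with the finer spacing sent to the limit), Theorem 2.1 (2.22) p. 654, (3.13) p. 657; the
NODE's predicates `T4EtaRate.EtaRateIneqUnit` ∕ `NE2PlusUnit` ([Balaban1985BackgroundPropagators] Thm 3.15 (3.187) p. 432 as quantifier template — HYPOTHESIS SHAPES,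
not printed) on the family `(e_M, K) ↦ kingVolInstance d L (jvSucc e_M K)` (section 2's instances, re-indexed by volume exponent and scale count).  KING's OWN `A = 0`
MODEL, one diagram's kernels; NOT `Z`, NOT Bałaban's `G(U)` ∕ `C^{(k)}(Λ; U)`; NOT a node discharge (N15 is booked through n15-a's knit); nothing continuum-ℝ⁴ ∕ OS ∕
mass-gap ∕ Clay.  0 `sorry`; standard axioms; plumbing `def`s only (the limit kernel as `limUnder`, the `SiteKernel` bundle).  Pages re-read 2026-08-29.  The vacuum energy
DENSITY (Theorem 2.1 (ii)'s content for one diagram) is part Β-f₁ (`…GraphTreeDecayContinuumDensity`).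

THE PRINT.  p. 674 [PDF 26] (4.38): *«|C^{(k)}(x, y) − C^{(k+n)}(x, y)| ≤ CL^{−k}e^{−δ₀|x−y|}»* (uniform in `n`); p. 657 (3.13): *«converges to a unique limit as κ → ∞.»*

READING (declared; ours).  (1) With part Β-e, the two-point kernel `E^{(K+1)}(G; y_b, y_{b′})` of a connected diagram converges; `kingPairLim` is ITS LIMIT (Mathlib's
`limUnder`, identified by `Tendsto.limUnder_eq`), and part Β-e's bounds read: `|E^{(K+1)} − E^{(∞)}| ≤ (B_G L^{−γ}e^{−δ|b−b′|_T})(L^{−γ})^K∕(1−L^{−γ})` — (4.38)'s shape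
with `n = ∞` — and `|E^{(∞)}| ≤ S_G e^{δ′}e^{−δ′|b−b′|_T}`.  (2) Re-indexing section 2's family by `(e_M, K) ↦ jvSucc e_M K` (scale count `K + 1`), the difference TO THE
LIMIT `b, b′ ↦ E^{(K+1)}(G; y_b, y_{b′}) − E^{(∞)}(G; b, b′)` is a `SiteKernel` obeying `EtaRateIneqUnit … B₀ δ θ (K+1)` with `θ = L^{−γ}`,
`B₀ = B_G∕(1 − L^{−γ})` (the factor `L^{−γ}·θ^K = θ^{K+1}`) ⇒ ★★★ `NE2PlusUnit` for the CONTINUUM-REFERENCED η-difference of every two-legged (3.56)-kernel; §3 with NO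
hypothesis for connected pseudoforests of `G`-lines in `1 ≤ d ≤ 3`.

WHAT THIS FILE PROVES (namespace `Summit.QuantumFields.YangMills.BalabanUVNodes.N15KingModelRung.Curved`).  §1 `kingPairLim`, ★ `tendsto_kingPairLim`,
★★ `kingPairSeq_sub_lim_le` ((4.38), `n = ∞`), ★★ `kingPairLim_abs_le`.  §2 `kingGraphLimUnit`, ★★★ **`etaRateIneqUnit_kingGraph_limit`**, ★★★ **`ne2PlusUnit_kingGraph_limit`**,
§3 ★★ `ne2PlusUnit_kingGraph_limit_pseudoforest`.

HONEST SCOPE.  (a) As parts Β-d∕Β-e: one diagram of King's `A = 0` model at fixed torus; legs = the two kernel members of (3.71); p. 664's sentence is the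
hypothesis (discharged for pseudoforests); §3.5 not typed.  (b) The NE2 predicate is inhabited on the re-indexed one-point-background family — a statement about
King's composite kernels and their `κ → ∞` limits, nothing about Bałaban's `C^{(k)}(Λ; U)`.  (c) N15 untouched; counts unmoved.
Locators: [King1986] Thm 2.1 (2.22) p.654, (3.13) p.657, Thm 3.3 (3.6) p.656, Prop. 3.6 (3.56) p.662, p.664, Lemma 4.5 (4.38) p.674; [B9] Thm 3.15 (3.187) p.432.
-/

noncomputable section

open scoped BigOperators Topology
open Finset Filter

namespace Summit.QuantumFields.YangMills.BalabanUVNodes.N15KingModelRung.Curved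

open Literature.MathematicalPhysics.QuantumFieldTheory.Balaban1983to89
open Literature.MathematicalPhysics.QuantumFieldTheory.Balaban1983to89.B5Prop11Plancherel (Tor fine)
open Literature.MathematicalPhysics.QuantumFieldTheory.Balaban1983to89.T4EtaRate (EtaRateIneqUnit NE2PlusUnit)
open Literature.MathematicalPhysics.QuantumFieldTheory.Balaban1983to89.T4EtaRateUnitWitness (NE2ZeroUnit ne2ZeroUnit_of_ne2PlusUnit)
open Literature.MathematicalPhysics.QuantumFieldTheory.King1986.Torus (tdistT tdistT_nonneg)
open Summit.QuantumFields.YangMills.BalabanUVNodes.N15KingModelRung (KingVolIndex kingVol kingVol_neZero kingVolInstance kingUnitDist)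
open Summit.QuantumFields.YangMills.BalabanUVNodes.N15KingModelRung.Graph

variable {d : ℕ} (L : ℕ) [NeZero L]

/-! ## §1 The continuum two-point kernel as a function, and (4.38)'s shape with `n = ∞` -/

section LimitKernel

/-- **THE CONTINUUM TWO-POINT KERNEL** `E^{(∞)}(G; b, b′) := lim_{K→∞} E^{(K+1)}(G; y_b, y_{b′})` (Mathlib's `limUnder`; it IS the limit whenever the sequence converges,
part Β-e). [cite: King1986, Thm 2.1 (i) (2.22) p.654, (3.13) p.657] -/
def kingPairLim (a msq : ℝ) (eM nn m : ℕ) (src tgt : Fin m → Fin (nn + 1)) (κ : Fin m → Option (Fin (d + 1))) (v₁ : Fin (nn + 1))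
    (κ₀ κ₁ : Option (Fin (d + 1))) (b b' : Tor (kingVol L (jvSucc (d := d) eM 0))) : ℝ :=
  limUnder atTop (kingPairSeq L a msq eM nn m src tgt κ v₁ κ₀ κ₁ b b')

/-- ★ **THE SEQUENCE CONVERGES TO `kingPairLim`** (part Β-e's existence + `Tendsto.limUnder_eq`), under p. 664's sentence. [cite: King1986, Thm 2.1 (i) (2.22) p.654, (3.13) p.657] -/
theorem tendsto_kingPairLim (hLodd : Odd L) (hL : 2 ≤ L) {a : ℝ} (ha : 0 < a) {m0sq msq : ℝ} (hm0 : 0 ≤ m0sq) (hm : 0 < msq) (hcap : msq ≤ m0sq)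
    (eM : ℕ) {nn m : ℕ} {src tgt : Fin m → Fin (nn + 1)} (hconn : ∀ v, LConn src tgt univ 0 v)
    {κ : Fin m → Option (Fin (d + 1))} (hsub : PosSubgraphsBy src tgt 0 ((d + 1 : ℕ) : ℝ) (fun ℓ => lineExp (d + 1) (κ ℓ)))
    (v₁ : Fin (nn + 1)) (κ₀ κ₁ : Option (Fin (d + 1))) (b b' : Tor (kingVol L (jvSucc (d := d) eM 0))) :
    Tendsto (kingPairSeq L a msq eM nn m src tgt κ v₁ κ₀ κ₁ b b') atTop (𝓝 (kingPairLim L a msq eM nn m src tgt κ v₁ κ₀ κ₁ b b')) := by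
  obtain ⟨A, γ, δ, -, -, -, H⟩ := king_graphPair_continuumLimit (d := d) L hLodd hL ha hm0
  obtain ⟨Einf, hlim, -⟩ := H msq hm hcap eM nn m src tgt hconn κ hsub v₁ κ₀ κ₁ b b'
  unfold kingPairLim
  rwa [hlim.limUnder_eq]

/-- ★★ **LEMMA 4.5 (4.38)'s SHAPE WITH `n = ∞`**: with part Β-e's `(A, γ, δ)`, under p. 664's sentence, for every `K` and unit sites `b, b′`:
`|E^{(K+1)}(G; y_b, y_{b′}) − E^{(∞)}(G; b, b′)| ≤ ((e^{δ}A^{2m+nn+2}m!(m+3))·L^{−γ}·e^{−δ|b−b′|_T})·(L^{−γ})^K∕(1 − L^{−γ})`.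
[cite: King1986, Lemma 4.5 (4.38) p.674 (shape), Thm 2.1 (i) (2.22) p.654, Prop. 3.6 (3.56) p.662] -/
theorem kingPairSeq_sub_lim_le (hLodd : Odd L) (hL : 2 ≤ L) {a : ℝ} (ha : 0 < a) {m0sq : ℝ} (hm0 : 0 ≤ m0sq) :
    ∃ A γ δ : ℝ, 1 ≤ A ∧ 0 < γ ∧ 0 < δ ∧ ∀ (msq : ℝ), 0 < msq → msq ≤ m0sq → ∀ (eM nn m : ℕ) (src tgt : Fin m → Fin (nn + 1)), (∀ v, LConn src tgt univ 0 v) →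
      ∀ (κ : Fin m → Option (Fin (d + 1))), PosSubgraphsBy src tgt 0 ((d + 1 : ℕ) : ℝ) (fun ℓ => lineExp (d + 1) (κ ℓ)) →
      ∀ (v₁ : Fin (nn + 1)) (κ₀ κ₁ : Option (Fin (d + 1))) (b b' : Tor (kingVol L (jvSucc (d := d) eM 0))) (K : ℕ),
        haveI := kingVol_neZero L (jvSucc (d := d) eM 0)
        |kingPairSeq L a msq eM nn m src tgt κ v₁ κ₀ κ₁ b b' K - kingPairLim L a msq eM nn m src tgt κ v₁ κ₀ κ₁ b b'|
          ≤ ((Real.exp δ * A ^ (2 * m + nn + 2) * ((m.factorial : ℝ) * (m + 3))) * (L : ℝ) ^ (-γ)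
              * Real.exp (-(δ * tdistT (kingVol L (jvSucc (d := d) eM 0)) b b'))) * ((L : ℝ) ^ (-γ)) ^ K / (1 - (L : ℝ) ^ (-γ)) := by
  obtain ⟨A, γ, δ, hA, hγ, hδ, H⟩ := king_graphPair_continuumLimit (d := d) L hLodd hL ha hm0
  refine ⟨A, γ, δ, hA, hγ, hδ, fun msq hm hcap eM nn m src tgt hconn κ hsub v₁ κ₀ κ₁ b b' K => ?_⟩
  obtain ⟨Einf, hlim, hK⟩ := H msq hm hcap eM nn m src tgt hconn κ hsub v₁ κ₀ κ₁ b b'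
  have heq : kingPairLim L a msq eM nn m src tgt κ v₁ κ₀ κ₁ b b' = Einf := by
    unfold kingPairLim; exact hlim.limUnder_eq
  rw [heq]
  exact hK K

/-- ★★ **THE CONTINUUM KERNEL DECAYS** (Thm 3.3 (3.6)'s shape): with part Β-e's `(C₁, C₂, Q, δ′)`, under p. 664's sentence,
`|E^{(∞)}(G; b, b′)| ≤ (Q·c368 δ′·C₁^m C₂^{nn}·(Σ_π degConst)·Q)·e^{δ′}·e^{−δ′|b−b′|_T}`. [cite: King1986, Thm 3.3 (3.6) p.656 (shape), Thm 3.5 (3.38) p.660, (3.13) p.657] -/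
theorem kingPairLim_abs_le (hLodd : Odd L) (hL : 2 ≤ L) {a : ℝ} (ha : 0 < a) {m0sq : ℝ} (hm0 : 0 ≤ m0sq) :
    ∃ C₁ C₂ Q δ : ℝ, 0 < C₁ ∧ 0 < C₂ ∧ 0 < Q ∧ 0 < δ ∧ ∀ (msq : ℝ), 0 < msq → msq ≤ m0sq →
      ∀ (eM nn m : ℕ) (src tgt : Fin m → Fin (nn + 1)), (∀ v, LConn src tgt univ 0 v) →
      ∀ (κ : Fin m → Option (Fin (d + 1))), PosSubgraphsBy src tgt 0 ((d + 1 : ℕ) : ℝ) (fun ℓ => lineExp (d + 1) (κ ℓ)) →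
      ∀ (v₁ : Fin (nn + 1)) (κ₀ κ₁ : Option (Fin (d + 1))) (b b' : Tor (kingVol L (jvSucc (d := d) eM 0))),
        haveI := kingVol_neZero L (jvSucc (d := d) eM 0)
        |kingPairLim L a msq eM nn m src tgt κ v₁ κ₀ κ₁ b b'|
          ≤ ((Q * c368 d δ) * (C₁ ^ m * C₂ ^ nn
                * (∑ π : Equiv.Perm (Fin m), degConst L (kingDegList src tgt ((d + 1 : ℕ) : ℝ) (fun ℓ => lineExp (d + 1) (κ ℓ)) π)) * Q))
              * (Real.exp δ * Real.exp (-(δ * tdistT (kingVol L (jvSucc (d := d) eM 0)) b b'))) := by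
  obtain ⟨C₁, C₂, Q, δ, hC₁, hC₂, hQ, hδ, H⟩ := king_graphPair_limit_decay (d := d) L hLodd hL ha hm0
  refine ⟨C₁, C₂, Q, δ, hC₁, hC₂, hQ, hδ, fun msq hm hcap eM nn m src tgt hconn κ hsub v₁ κ₀ κ₁ b b' => ?_⟩
  exact H msq hm hcap eM nn m src tgt hconn κ hsub v₁ κ₀ κ₁ b b' _ (tendsto_kingPairLim L hLodd hL ha hm0 hm hcap eM hconn hsub v₁ κ₀ κ₁ b b')

end LimitKernel

/-! ## §2–§3 NE2's unit layer against the continuum kernel, on the family re-indexed by `(e_M, K)`; the hypothesis-free class -/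

section NE2Limit

/-- **THE η-DIFFERENCE TO THE CONTINUUM KERNEL AS A `SiteKernel`** on the family `(e_M, K) ↦ kingVolInstance d L (jvSucc e_M K)` (volume `2L^{e_M}`, `K + 1` scales):
`b, b′ ↦ E^{(K+1)}(G; y_b, y_{b′}) − E^{(∞)}(G; b, b′)`. [cite: Balaban1985BackgroundPropagators, Thm 3.15 (3.187) p.432 (shape); King1986, Lemma 4.5 (4.38) p.674] -/
def kingGraphLimUnit (a msq : ℝ) (nn m : ℕ) (src tgt : Fin m → Fin (nn + 1)) (κ : Fin m → Option (Fin (d + 1)))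
    (v₁ : Fin (nn + 1)) (κ₀ κ₁ : Option (Fin (d + 1))) :
    ∀ p : ℕ × ℕ, B9.SiteKernel (kingVolInstance d L (jvSucc (d := d) p.1 p.2)).gc (kingVolInstance d L (jvSucc (d := d) p.1 p.2)).Bf :=
  fun p => ⟨fun _ b b' => kingPairSeq L a msq p.1 nn m src tgt κ v₁ κ₀ κ₁ b b' p.2 - kingPairLim L a msq p.1 nn m src tgt κ v₁ κ₀ κ₁ b b'⟩

/-- ★★★ **THE TYPED UNIT INEQUALITY AGAINST THE CONTINUUM KERNEL**: there are `B₀, γ, δ > 0` (from part Β-e's `(A, γ, δ)`: `B₀ = e^{δ}A^{2m+nn+2}m!(m+3)∕(1 − L^{−γ})`) such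
that under p. 664's sentence, for every `(e_M, K)` and (the unique) background:
`EtaRateIneqUnit (kingGraphLimUnit … (e_M, K)) (fun _ => True) (kingUnitDist L (jvSucc e_M K)) B₀ δ L^{−γ} (K+1) U` — `L^{−γ}·(L^{−γ})^K = (L^{−γ})^{K+1}` is the clean rate
at `K + 1` scales. [cite: Balaban1985BackgroundPropagators, Thm 3.15 (3.187) p.432 (shape); King1986, Lemma 4.5 (4.38) p.674, Thm 2.1 (i) (2.22) p.654] -/
theorem etaRateIneqUnit_kingGraph_limit (hLodd : Odd L) (hL : 2 ≤ L) {a : ℝ} (ha : 0 < a) {m0sq : ℝ} (hm0 : 0 ≤ m0sq) :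
    ∃ A γ δ : ℝ, 1 ≤ A ∧ 0 < γ ∧ 0 < δ ∧ ∀ (msq : ℝ), 0 < msq → msq ≤ m0sq →
      ∀ (nn m : ℕ) (src tgt : Fin m → Fin (nn + 1)), (∀ v, LConn src tgt univ 0 v) →
      ∀ (κ : Fin m → Option (Fin (d + 1))), PosSubgraphsBy src tgt 0 ((d + 1 : ℕ) : ℝ) (fun ℓ => lineExp (d + 1) (κ ℓ)) →
      ∀ (v₁ : Fin (nn + 1)) (κ₀ κ₁ : Option (Fin (d + 1))) (p : ℕ × ℕ) (U : (kingVolInstance d L (jvSucc (d := d) p.1 p.2)).Bf.Cfg),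
        EtaRateIneqUnit (kingGraphLimUnit L a msq nn m src tgt κ v₁ κ₀ κ₁ p) (fun _ => True) (kingUnitDist L (jvSucc (d := d) p.1 p.2))
          ((Real.exp δ * A ^ (2 * m + nn + 2) * ((m.factorial : ℝ) * (m + 3))) / (1 - (L : ℝ) ^ (-γ))) δ ((L : ℝ) ^ (-γ)) (p.2 + 1) U := by
  obtain ⟨A, γ, δ, hA, hγ, hδ, H⟩ := kingPairSeq_sub_lim_le (d := d) L hLodd hL ha hm0
  refine ⟨A, γ, δ, hA, hγ, hδ, fun msq hm hcap nn m src tgt hconn κ hsub v₁ κ₀ κ₁ p U => ?_⟩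
  obtain ⟨eM, K⟩ := p
  intro y y' _ _
  have h := H msq hm hcap eM nn m src tgt hconn κ hsub v₁ κ₀ κ₁ y y' K
  show |kingPairSeq L a msq eM nn m src tgt κ v₁ κ₀ κ₁ y y' K - kingPairLim L a msq eM nn m src tgt κ v₁ κ₀ κ₁ y y'| ≤
    (Real.exp δ * A ^ (2 * m + nn + 2) * ((m.factorial : ℝ) * (m + 3))) / (1 - (L : ℝ) ^ (-γ))
      * Real.exp (-(δ * (haveI := kingVol_neZero L (jvSucc (d := d) eM K); tdistT (kingVol L (jvSucc (d := d) eM K)) y y'))) * ((L : ℝ) ^ (-γ)) ^ (K + 1)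
  have hL1r : (1 : ℝ) < L := by exact_mod_cast (show 1 < L by omega)
  have hr1 : (L : ℝ) ^ (-γ) < 1 := Real.rpow_lt_one_of_one_lt_of_neg hL1r (by linarith)
  have h1r : 0 < 1 - (L : ℝ) ^ (-γ) := by linarith
  haveI := kingVol_neZero L (jvSucc (d := d) eM K)
  haveI := kingVol_neZero L (jvSucc (d := d) eM 0)
  rw [show (tdistT (kingVol L (jvSucc (d := d) eM K)) y y' : ℝ) = tdistT (kingVol L (jvSucc (d := d) eM 0)) y y' from rfl]
  calc _ ≤ _ := h
    _ = _ := by rw [pow_succ]; ring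

/-- ★★★ **`NE2PlusUnit` AGAINST THE CONTINUUM KERNEL — NE2's UNIT LAYER DECIDED IN THE MODEL WITH THE FINER SPACING SENT TO THE LIMIT**: for odd `L ≥ 3`, `a > 0`, mass
`0 < m² ≤ m₀²`, a CONNECTED numbered graph under p. 664's sentence, `v₁, κ₀, κ₁` and every `c35`:
`NE2PlusUnit c35 (fun p => kingVolInstance d L (jvSucc p.1 p.2)) (kingGraphLimUnit …) (fun _ _ => True) (fun p => kingUnitDist L (jvSucc p.1 p.2))` with
`(δ₀, a₀, B₀, θ) = (δ, 1, e^{δ}A^{2m+nn+2}m!(m+3)∕(1 − L^{−γ}), L^{−γ})`, uniform in volume and scale count.  HONEST: one-point backgrounds; Bałaban's `C^{(k)}(Λ; U)` untouched.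
[cite: Balaban1985BackgroundPropagators, Thm 3.15 (3.187) p.432 (quantifier template); King1986, Lemma 4.5 (4.38) p.674, Thm 2.1 (i) (2.22) p.654] -/
theorem ne2PlusUnit_kingGraph_limit (hLodd : Odd L) (hL : 2 ≤ L) {a : ℝ} (ha : 0 < a) {m0sq msq : ℝ} (hm0 : 0 ≤ m0sq) (hm : 0 < msq) (hcap : msq ≤ m0sq)
    {nn m : ℕ} {src tgt : Fin m → Fin (nn + 1)} (hconn : ∀ v, LConn src tgt univ 0 v)
    {κ : Fin m → Option (Fin (d + 1))} (hsub : PosSubgraphsBy src tgt 0 ((d + 1 : ℕ) : ℝ) (fun ℓ => lineExp (d + 1) (κ ℓ)))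
    (v₁ : Fin (nn + 1)) (κ₀ κ₁ : Option (Fin (d + 1))) (c35 : ℝ) :
    NE2PlusUnit c35 (fun p : ℕ × ℕ => kingVolInstance d L (jvSucc (d := d) p.1 p.2)) (kingGraphLimUnit L a msq nn m src tgt κ v₁ κ₀ κ₁)
      (fun _ _ => True) (fun p => kingUnitDist L (jvSucc (d := d) p.1 p.2)) := by
  obtain ⟨A, γ, δ, hA, hγ, hδ, H⟩ := etaRateIneqUnit_kingGraph_limit (d := d) L hLodd hL ha hm0
  have hL1r : (1 : ℝ) < L := by exact_mod_cast (show 1 < L by omega)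
  have hθ0 : 0 < (L : ℝ) ^ (-γ) := Real.rpow_pos_of_pos (by linarith) _
  have hθ1 : (L : ℝ) ^ (-γ) < 1 := Real.rpow_lt_one_of_one_lt_of_neg hL1r (by linarith)
  have hB : 0 < (Real.exp δ * A ^ (2 * m + nn + 2) * ((m.factorial : ℝ) * (m + 3))) / (1 - (L : ℝ) ^ (-γ)) := by
    have := zero_le_one.trans hA
    have hf : (0 : ℝ) < m.factorial := by exact_mod_cast m.factorial_pos
    have h1r : 0 < 1 - (L : ℝ) ^ (-γ) := by linarith
    positivity
  exact ⟨δ, 1, _, (L : ℝ) ^ (-γ), hδ, one_pos, hB, hθ0, hθ1,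
    fun p _ _ _ U _ _ => H msq hm hcap nn m src tgt hconn κ hsub v₁ κ₀ κ₁ p U⟩

/-- ★★ **THE SAME WITH NO HYPOTHESIS FOR TWO-LEGGED CONNECTED PSEUDOFORESTS OF `G`-LINES** (`1 ≤ d ≤ 3`). [cite: King1986, Lemma 4.5 (4.38) p.674, Prop. 3.6 (3.56) p.662, p.664] -/
theorem ne2PlusUnit_kingGraph_limit_pseudoforest (hd1 : 1 ≤ d) (hd3 : d ≤ 3) (hLodd : Odd L) (hL : 2 ≤ L) {a : ℝ} (ha : 0 < a) {m0sq msq : ℝ}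
    (hm0 : 0 ≤ m0sq) (hm : 0 < msq) (hcap : msq ≤ m0sq) {nn m : ℕ} {src tgt : Fin m → Fin (nn + 1)}
    (hconn : ∀ v, LConn src tgt univ 0 v) (h1 : ∀ ℓ, src ℓ ≠ tgt ℓ) (h2 : ∀ S : Finset (Fin m), S.card ≤ (lineVerts src tgt S).card)
    (h3 : ∀ S : Finset (Fin m), S.card = 2 → 3 ≤ (lineVerts src tgt S).card) (v₁ : Fin (nn + 1)) (κ₀ κ₁ : Option (Fin (d + 1))) (c35 : ℝ) :
    NE2PlusUnit c35 (fun p : ℕ × ℕ => kingVolInstance d L (jvSucc (d := d) p.1 p.2))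
      (kingGraphLimUnit L a msq nn m src tgt (fun _ : Fin m => (none : Option (Fin (d + 1)))) v₁ κ₀ κ₁)
      (fun _ _ => True) (fun p => kingUnitDist L (jvSucc (d := d) p.1 p.2)) :=
  ne2PlusUnit_kingGraph_limit L hLodd hL ha hm0 hm hcap hconn (posSubgraphsBy_lineExp_pseudoforest hd1 hd3 h1 h2 h3) v₁ κ₀ κ₁ c35

end NE2Limit



end Summit.QuantumFields.YangMills.BalabanUVNodes.N15KingModelRung.Curved

end
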